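/-
Copyright (c) 2026 the pub-hodgecm-mathlib formalisation cell (harness21).  Prover seat hodgecm-mathlib-K2E5-p04 (g3), HCML Track B «K2-LIT» (build stream 29),
h413 = `stmt-HodgeConjecture-24833`, line `K2_E3_EllipticInputs`, unit U12 «Characters», socket #11 road (11-SC), letter (SC-an), END-GAME MAP v1 (line lead
K2E3-p20 (g3) `K2/STATUS.md` 2026-09-04T02:22:50Z, re-seated K2E3-p14 (g3)), brick [M6] «LIMIT AND CANCELLATION»: the `hlim` ∕ `hcanc` clauses of the (SC-an)
consumers on `(cmDatum L 3 H).Local v` — deal (D27) K2E3-plan (g2) 2026-09-04T02:28Z.  2026-09-04.  ED. 2: docstring-only (one `[cite:]` tag un-wrapped, lit1 (5219)).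
-/
import Summits.HodgeConjecture.HodgeConjecture.Theorems.K2E3SupercuspidalTruncatedCharThm20      -- ★ [M4] p856742 (K2E3-p20): `setIntegral_sdiff_heightBall_coeff_conj_eq_zero` (Theorem 20 pays the split-regular shell); brings ★ [M1], ★ [M3], ★ (f1)
import Summits.HodgeConjecture.HodgeConjecture.Theorems.K2E3TruncatedCharTransport               -- ★ [M5′] p856751 (K2E3-p20): `exists_compactExhaustion_preimage`, `truncated_eq_inter_and_tendsto_of_map`, `ρ ∘ e⁻¹` smooth ∕ supercuspidal, `coeff_comp_symm_apply`
import Summits.HodgeConjecture.HodgeConjecture.Theorems.K2E3SupercuspModelFrameAtPlaceCartan     -- ★ [M2a] FILE B p856832 (K2E3-p14): (d) `exists_conj_torusU_of_not_isCompact_centralizer`, (f) `exists_isCompact_support_coeff_conj_subset_mul_torusU`; brings ★ FILE A p856783 (a)(b)(c)(e)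
import Summits.HodgeConjecture.HodgeConjecture.Theorems.K2E3RankOneIsotropicPhi3Model            -- ★ (f2) p856722 (K2E3-p14): `isotropic_or_anisotropic`, `nonempty_continuousMulEquiv_cmLocal_fieldModel_of_isotropic`
import Summits.HodgeConjecture.HodgeConjecture.Theorems.K2E3HeightBallExhaustion                 -- ★ p856390 (K2E3-p20): `exists_heightBall_compactExhaustion` (the height balls `Ω m` of the model; `hmem` `hinv` `hmul`)
import Summits.HodgeConjecture.HodgeConjecture.Theorems.K2E3UnipotentConjTwistBochner            -- ★ p856617 (K2E3-p20): `exists_isCompact_subset_mul_of_isCompact_image_mk` (Lemma 14's output read as `⊆ C·Z`)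
import Summits.HodgeConjecture.HodgeConjecture.Theorems.K2E3SupercuspidalTruncatedCharDominationOfBricks  -- ★ p856355 (K2E3-p20): the CONSUMER `sigSCan_datum_of_bricks` (docking §4); brings ★ p856184
import Literature.NumberTheory.Automorphic.ConjugationProperOnRegularCompacta                     -- ★ `UnitaryGroupOfForm.isCompact_image_mk_setOf_exists_conj_mem_of_charpoly_separable` (Harish-Chandra's Lemma 14 at the model)
import Literature.NumberTheory.Automorphic.AdmissibleInvariantFormSchur                           -- ★ `Representation.IsSupercuspidal.hasCompactSupport_sesqForm_apply_apply`
import Literature.NumberTheory.Automorphic.AnisotropicUnitaryGroupCompactLocal                   -- ★ `UnitaryGroup.compactSpace_local_of_anisotropic` (anisotropic `H_w` ⇒ compact local group), `exists_v_eq_exp_neg_one_adicCompletion`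
import Literature.NumberTheory.Automorphic.AdicCompletionLocalField                               -- ★ instances: `L_w` is a non-archimedean local field (`ValuativeRel`, `Compatible`, `IsNonarchimedeanLocalField`)
import Literature.NumberTheory.Automorphic.LocalUnitaryGroupCongrMeasure                          -- ★ instances on `(cmDatum L N H).Local v` (locally compact, T₂, second countable)
import HarnessLib

/-!
# h413 ∕ Track B «K2-LIT», line `K2_E3_EllipticInputs`, unit U12, road (11-SC), letter (SC-an) — brick [M6]: LIMIT AND CANCELLATION OF THE TRUNCATED
# SUPERCUSPIDAL CHARACTER INTEGRALS ON `U₃(H)(L⁺_v)` — `Θₙ(g) = ∫_{Ω n ∩ Ω R(g)}` and `Θₙ(g) → Θ_{R(g)}(g)` for Haar-almost every `g`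
# (Harish-Chandra 1970, Part VII §3 p. 71 eq. (1), p. 72; Theorem 20; Lemma 14; Lemma 42)

Cell `pub/hodgecm-mathlib`, crux H413 = `stmt-HodgeConjecture-24833`, route of record `HCCMUnconditional`; chair K2-lead (g0), dealer K2E3-plan (g2) (deal (D27)
2026-09-04T02:28Z), line lead K2E3-p14 (g3) (END-GAME MAP v1 of K2E3-p20 (g3)).  THEOREMS ONLY (no `def`, no `instance`, no `notation`, no named-fact hypothesis,
no `sorry`); lane `--supports stmt-HodgeConjecture-24833 --as helper`, count-neutral.  Census `K2/K2E5-p04/g3/CENSUS-M6.K2E5-p04-g3.md`.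

THE TARGET.  The two consumers of the (SC-an) letter on `G = (cmDatum L N H).Local v` (`v` non-split) — ★ p856184 `…OfTruncated.exists_locallyIntegrable_smoothTrace_eq_of_truncated`
and ★ p856355 `…DominationOfBricks.sigSCan_datum_of_bricks` — read, for the truncated orbital integrals `Θₙ(g) = ∫_{Ω n} B v₁ (ρ(x g x⁻¹) v₁) dμ(x)` of a supercuspidal
coefficient along a compact exhaustion `Ω` (a BINDER), `hlim : ∀ᵐ g, ¬ EllReg g → Θₙ(g) → F g` and `hcanc : ∀ n, ∀ᵐ g, ¬ EllReg g → Θₙ(g) = ∫_{Ω n ∩ Bset g} …` (`Bset g` compact;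
`EllReg g :≡ IsRegularElt g ∧ IsCompact Z(g)`).  THIS FILE inhabits them at `N = 3`, for EVERY hermitian `H ∈ M₃(L)` with `det H ≠ 0`, every Haar `μ`, every SMOOTH SUPERCUSPIDAL `ρ`
(no irreducibility) with a `ρ`-invariant sesquilinear `B` and any `u, u′`, in the GUARD-FREE form **`∃ Ω, ∀ᵐ g ∂μ, ∃ R, (∀ n, Θₙ(g) = ∫_{Ω n ∩ Ω R}) ∧ Θₙ(g) → Θ_R(g)`**
(`F g := Θ_{R(g)}(g)`, `Bset g := Ω (R g)`), by the dichotomy on the one-place form `H_w` (`w ∣ v`, `w̄ = w`; ★ (f2) `isotropic_or_anisotropic`):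
* `H_w` ANISOTROPIC: `G` is COMPACT (★ `UnitaryGroup.compactSpace_local_of_anisotropic`), so every compact exhaustion is STATIONARY (`Ω N = G`) and `R := N` serves EVERY `g` (§1).
* `H_w` ISOTROPIC: ★ (f2) gives `e : G ≃ₜ* M` onto the quasi-split field model `M = U(σ_w, Φ₃)(L_w)`; `Ω := e⁻¹(Ω_M)` for the height balls `Ω_M` of ★ p856390 (★ [M5′] §1).  On `M`,
  for `ρ_M = ρ ∘ e⁻¹` (★ [M5′] §3) and the Haar measure `e_* μ` (right invariant: ★ [M2a] (c)), the SHELL VANISHING `∃ R, ∀ n, ∫_{Ω_M n ∖ Ω_M R} θ_M(x m x⁻¹) = 0` holds at every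
  REGULAR `m` (§2): `Z_M(m)` NOT compact ⇒ `m = y t y⁻¹`, `t` regular diagonal (★ [M2a] (d)) and Theorem 20 pays (★ [M4], support datum ★ [M2a] (f)); `Z_M(m)` compact ⇒ the
  integrand is compactly supported (Lemma 14 at the model ★ `UnitaryGroupOfForm.isCompact_image_mk_setOf_exists_conj_mem_of_charpoly_separable` + ★
  `IsSupercuspidal.hasCompactSupport_sesqForm_apply_apply`) inside some `Ω_M R`.  The two shapes follow (★ (f1) §4) and TRANSPORT to `G` (★ [M5′] §2); «almost every» =
  «`e g` regular» (★ [M2a] (e), pulled back by Mathlib `ae_of_ae_map`).  REGULARITY IS NEVER READ ON `G` (the iso of ★ (f2) is abstract): the `¬ EllReg` guard is idle.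
Heads: §3 **`exists_exhaustion_ae_truncated_eq_inter_and_tendsto`** (MAIN, guard-free), **`exists_exhaustion_limit_localisation`** (EXACTLY the binders `Ω F Bset hBsetc` +
`hlim` + `hcanc` of the consumers), §4 **`sigSCan_datum_of_domination_bricks`** (the (SC-an) ∃-statement for a supercuspidal `SmoothIrrep` MODULO the domination bricks
`hballE`, `hball`, `hW` of ★ p856355, by name over ★ `sigSCan_datum_of_bricks`).
HONEST LABEL.  HC_CM is proved only modulo the 7 printed citations (2 remaining named inputs: hLiu418 = `stmt-HodgeConjecture-24832`, h413 = `stmt-HodgeConjecture-24833`)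
until rung 0 closes; count-neutral helper: after it the (SC-an) letter at `N = 3` is ★ MODULO `hball`, `hballE`, `hW` ([M5]: Harish-Chandra's Thms 14, 15, 18, 19), NOT proved here.

## References
* [HarishChandra1970] Harish-Chandra (notes by G. van Dijk), *Harmonic Analysis on Reductive p-adic Groups*, LNM 162 (1970), Part I §3 Lemma 14 p. 9; Part V Lemma 42;
  Part VII §2 Theorem 20 p. 70, §3 p. 71 eq. (1), p. 72.
* [Rogawski1990] J. D. Rogawski, *Automorphic Representations of Unitary Groups in Three Variables*, Ann. of Math. Stud. 123 (1990), §3.6 pp. 28–31, §4.9 p. 54, §12.2 p. 173,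
  §12.5 p. 182, §14.2 p. 232.
* [PlatonovRapinchuk1994] V. Platonov, A. Rapinchuk, *Algebraic Groups and Number Theory* (1994), §3.1 Thm. 3.1, §5.1.
* [Folland1995] G. B. Folland, *A Course in Abstract Harmonic Analysis* (1995), §2.4.
-/

set_option autoImplicit false
-- the mandated namespace repeats the single-problem summit's segment (`HodgeConjecture.HodgeConjecture`)
set_option linter.dupNamespace false

noncomputable section

open MeasureTheory Measure Set Filter Topology NumberField IsDedekindDomain
open scoped NNReal ENNReal Pointwise Matrix MatrixGroups WithZero
open ValuativeRel
open Literature.NumberTheory.Automorphic Literature.NumberTheory.Automorphic.UnitaryGroup Literature.NumberTheory.Rogawski1990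
open Literature.NumberTheory.GaloisRepresentations

namespace Summit.HodgeConjecture.HodgeConjecture.Cruxes.H413.K2E3SupercuspidalTruncatedCharLimCanc

/-! ## §1 Generic: stationary exhaustions of a compact group; shell vanishing from compact support -/

section Generic

variable {G : Type*} [TopologicalSpace G]

/-- **A compact exhaustion of a COMPACT space is stationary**: `Ω N = univ` for some `N` (Mathlib `CompactExhaustion.exists_superset_of_isCompact` at `univ`).
[cite: Folland1995, §2.4] -/
theorem exists_coe_eq_univ_of_compactSpace [CompactSpace G] (Ω : CompactExhaustion G) : ∃ N : ℕ, (Ω N : Set G) = univ :=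
  (Ω.exists_superset_of_isCompact isCompact_univ).imp fun _ h => Set.eq_univ_of_univ_subset h

variable [MeasurableSpace G] {E : Type*} [NormedAddCommGroup E] [NormedSpace ℝ E]

/-- **On a COMPACT space the two consumer shapes hold at EVERY point, for EVERY integrand**: with `Ω N = univ`, `∫_{Ω n} ψ = ∫_{Ω n ∩ Ω N} ψ` for all `n`
and `∫_{Ω n} ψ = ∫_{Ω N} ψ` for `n ≥ N`.  (The anisotropic branch of the (SC-an) assembly: the local unitary group of an anisotropic form is compact, every
regular element is elliptic, and the truncation is eventually trivial.) [cite: HarishChandra1970, Part VII §3 p. 72] [cite: Rogawski1990, §14.2 p. 232] -/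
theorem forall_exists_truncated_eq_inter_and_tendsto_of_compactSpace [CompactSpace G] (μ : Measure G) (Ω : CompactExhaustion G) (ψ : G → G → E) :
    ∀ g : G, ∃ R : ℕ, (∀ n : ℕ, ∫ x in Ω n, ψ g x ∂μ = ∫ x in Ω n ∩ Ω R, ψ g x ∂μ) ∧
      Tendsto (fun n : ℕ => ∫ x in Ω n, ψ g x ∂μ) atTop (𝓝 (∫ x in Ω R, ψ g x ∂μ)) := by
  obtain ⟨N, hN⟩ := exists_coe_eq_univ_of_compactSpace Ω
  intro g
  refine ⟨N, fun n => by rw [hN, Set.inter_univ], tendsto_atTop_of_eventually_const (i₀ := N) fun n hn => ?_⟩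
  have hn' : (Ω n : Set G) = univ := Set.eq_univ_of_univ_subset (hN ▸ Ω.subset hn)
  rw [hn', hN]

/-- **SHELL VANISHING FROM COMPACT SUPPORT**: if `ψ` vanishes off a compact `S`, then for the `R` with `S ⊆ Ω R` (Mathlib
`CompactExhaustion.exists_superset_of_isCompact`), `∫_{Ω n ∖ Ω R} ψ = 0` for every `n`.  (The regular-ELLIPTIC case of Harish-Chandra's eq. (1): the orbit map is proper,
the coefficient compactly supported.) [cite: HarishChandra1970, Part I §3 Lemma 14 p. 9; Part VII §3 p. 72] -/
theorem exists_forall_setIntegral_sdiff_eq_zero_of_subset (μ : Measure G) (Ω : CompactExhaustion G) (ψ : G → E) {S : Set G} (hS : IsCompact S)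
    (hψ : ∀ x, x ∉ S → ψ x = 0) : ∃ R : ℕ, ∀ n : ℕ, ∫ x in Ω n \ Ω R, ψ x ∂μ = 0 := by
  obtain ⟨R, hR⟩ := Ω.exists_superset_of_isCompact hS
  exact ⟨R, fun n => setIntegral_eq_zero_of_forall_eq_zero fun x hx => hψ x fun hxS => hx.2 (hR hxS)⟩

end Generic

/-! ## §2 The quasi-split field model `M = U(σ_w, Φ₃)(L_w)` at a non-split place: shell vanishing at every regular element, and the two shapes a.e. -/

section Model

variable (L : Type) [Field L] [NumberField L] [IsCMField L] {v : HeightOneSpectrum (𝓞 ↥(maximalRealSubfield L))}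
  (w : PlacesOver L v) (hw : IsCMField.complexConj L • w.1 = w.1)

/-- **SHELL VANISHING AT EVERY REGULAR ELEMENT OF THE MODEL** `M = U(σ_w, Φ₃)(L_w)`: for `θ_M = B u′ (ρ(·) u)` a coefficient of a smooth SUPERCUSPIDAL `ρ` of `M` (`B` invariant),
`μ` Haar, `Ω` the height-ball exhaustion (★ p856390's `hmem` `hinv` `hmul`) and `m` REGULAR, ONE radius `R` gives `∫_{Ω n ∖ Ω R} θ_M(x m x⁻¹) dμ(x) = 0` for every `n`.  Two Cartan
types: `Z(m)` NOT compact ⇒ `m = y t y⁻¹`, `t` regular diagonal (★ [M2a] FILE B (d)) and THEOREM 20 pays (★ [M4], support datum ★ FILE B (f), frame ★ FILE A); `Z(m)` compact ⇒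
the integrand is supported in the COMPACT `{x ∣ x m x⁻¹ ∈ supp θ_M}` (Lemma 14 at the model ★ `UnitaryGroupOfForm.isCompact_image_mk_setOf_exists_conj_mem_of_charpoly_separable`, ★
`IsSupercuspidal.hasCompactSupport_sesqForm_apply_apply`, compact centre ★ FILE A) and §1 applies.
[cite: HarishChandra1970, Part VII §2 Theorem 20 p. 70, §3 p. 71 eq. (1); Part I §3 Lemma 14 p. 9] [cite: Rogawski1990, §3.6 pp. 28–31, §4.9 p. 54, §12.2 p. 173] -/
theorem exists_forall_setIntegral_sdiff_coeff_conj_eq_zero_of_isRegularElt {J : Matrix (Fin 3) (Fin 3) (w.1.adicCompletion L)}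
    (hJ : J = (StdForm.antidiagonal 3).over (w.1.adicCompletion L))
    [MeasurableSpace ↥(unitaryGroupOfForm (galAdicCompletionMap (L := L) (IsCMField.complexConj L) hw) J)]
    [BorelSpace ↥(unitaryGroupOfForm (galAdicCompletionMap (L := L) (IsCMField.complexConj L) hw) J)]
    (μ : Measure ↥(unitaryGroupOfForm (galAdicCompletionMap (L := L) (IsCMField.complexConj L) hw) J)) [μ.IsHaarMeasure]
    (Ω : CompactExhaustion ↥(unitaryGroupOfForm (galAdicCompletionMap (L := L) (IsCMField.complexConj L) hw) J)) {ϖ : w.1.adicCompletion L}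
    (hϖ : Valued.v ϖ = WithZero.exp (-1 : ℤ))
    (hmem : ∀ (m : ℕ) (g : ↥(unitaryGroupOfForm (galAdicCompletionMap (L := L) (IsCMField.complexConj L) hw) J)), g ∈ Ω m ↔
      (∀ i j, Valued.v (ϖ ^ m * ((g : GL (Fin 3) (w.1.adicCompletion L)) : Matrix (Fin 3) (Fin 3) (w.1.adicCompletion L)) i j) ≤ 1) ∧
        ∀ i j, Valued.v (ϖ ^ m * (((g : GL (Fin 3) (w.1.adicCompletion L))⁻¹ : GL (Fin 3) (w.1.adicCompletion L)) :
          Matrix (Fin 3) (Fin 3) (w.1.adicCompletion L)) i j) ≤ 1)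
    (hinv : ∀ (m : ℕ) (g : ↥(unitaryGroupOfForm (galAdicCompletionMap (L := L) (IsCMField.complexConj L) hw) J)), g ∈ Ω m → g⁻¹ ∈ Ω m)
    (hmul : ∀ (a b : ℕ) (g h : ↥(unitaryGroupOfForm (galAdicCompletionMap (L := L) (IsCMField.complexConj L) hw) J)), g ∈ Ω a → h ∈ Ω b → g * h ∈ Ω (a + b))
    {V : Type*} [AddCommGroup V] [Module ℂ V]
    (ρ : Representation ℂ ↥(unitaryGroupOfForm (galAdicCompletionMap (L := L) (IsCMField.complexConj L) hw) J) V) (hsm : ρ.IsSmooth) (hsc : ρ.IsSupercuspidal)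
    (B : V →ₗ⋆[ℂ] V →ₗ[ℂ] ℂ)
    (hBinv : ∀ (g : ↥(unitaryGroupOfForm (galAdicCompletionMap (L := L) (IsCMField.complexConj L) hw) J)) (x y : V), B (ρ g x) (ρ g y) = B x y) (u u' : V)
    (m : ↥(unitaryGroupOfForm (galAdicCompletionMap (L := L) (IsCMField.complexConj L) hw) J)) (hreg : IsRegularElt (m : GL (Fin 3) (w.1.adicCompletion L))) :
    ∃ R : ℕ, ∀ n : ℕ, ∫ x in Ω n \ Ω R, B u' (ρ (x * m * x⁻¹) u) ∂μ = 0 := by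
  -- the frame of `L_w` and `M` (★ [M2a] FILE A; ★ `AdicCompletionLocalField` instances)
  letI : MeasurableSpace (w.1.adicCompletion L) := borel _
  haveI : BorelSpace (w.1.adicCompletion L) := ⟨rfl⟩
  haveI : SecondCountableTopology (w.1.adicCompletion L) := secondCountableTopology_adicCompletion L w.1
  haveI : CharZero (w.1.adicCompletion L) := charZero_of_injective_algebraMap (algebraMap L (w.1.adicCompletion L)).injective
  haveI : SecondCountableTopology (GL (Fin 3) (w.1.adicCompletion L)) := secondCountableTopology_gl_adicCompletion L 3 w.1
  haveI : LocallyCompactSpace (GL (Fin 3) (w.1.adicCompletion L)) := locallyCompactSpace_gl_adicCompletion L 3 w.1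
  haveI : SigmaCompactSpace (GL (Fin 3) (w.1.adicCompletion L)) := sigmaCompactSpace_of_locallyCompact_secondCountable
  haveI : SecondCountableTopology ↥(unitaryGroupOfForm (galAdicCompletionMap (L := L) (IsCMField.complexConj L) hw) J) :=
    K2E3SupercuspModelFrameAtPlace.secondCountableTopology_unitaryGroupOfForm_adicCompletion L w _ J
  haveI : LocallyCompactSpace ↥(unitaryGroupOfForm (galAdicCompletionMap (L := L) (IsCMField.complexConj L) hw) J) :=
    K2E3SupercuspModelFrameAtPlace.locallyCompactSpace_unitaryGroupOfForm_adicCompletion L w hw J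
  haveI : μ.IsMulRightInvariant := K2E3SupercuspModelFrameAtPlace.isMulRightInvariant_of_isHaarMeasure_of_eq_over L w hw hJ μ
  have hσσ : ∀ x, galAdicCompletionMap (L := L) (IsCMField.complexConj L) hw (galAdicCompletionMap (L := L) (IsCMField.complexConj L) hw x) = x :=
    galAdicCompletionMap_galAdicCompletionMap_of_smul_eq (IsCMField.complexConj L) w (IsCMField.complexConj_ne_one L) hw
  have hσc : Continuous (galAdicCompletionMap (L := L) (IsCMField.complexConj L) hw) := continuous_galAdicCompletionMap L (IsCMField.complexConj L) hw
  have hσv : ∀ x, Valued.v (galAdicCompletionMap (L := L) (IsCMField.complexConj L) hw x) = Valued.v x :=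
    fun x => valued_galAdicCompletionMap (L := L) (IsCMField.complexConj L) hw x
  have hZc := K2E3SupercuspModelFrameAtPlace.isCompact_center_of_eq_over L w hw hJ
  have hZs := K2E3SupercuspModelFrameAtPlace.exists_coe_eq_scalar_of_mem_center L w hw hJ
  obtain ⟨ϖ', hϖ'0, hϖ'1, hσϖ'⟩ := K2E3SupercuspModelFrameAtPlace.exists_ne_zero_valuation_lt_one_map_eq L w hw
  by_cases hZ : IsCompact ((Subgroup.centralizer ({m} : Set ↥(unitaryGroupOfForm (galAdicCompletionMap (L := L) (IsCMField.complexConj L) hw) J)) :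
      Subgroup ↥(unitaryGroupOfForm (galAdicCompletionMap (L := L) (IsCMField.complexConj L) hw) J)) :
        Set ↥(unitaryGroupOfForm (galAdicCompletionMap (L := L) (IsCMField.complexConj L) hw) J))
  · -- ELLIPTIC type: the integrand `x ↦ θ_M(x m x⁻¹)` is compactly supported
    subst hJ
    letI : NontriviallyNormedField (w.1.adicCompletion L) := Valued.toNontriviallyNormedField (w.1.adicCompletion L) (WithZero (Multiplicative ℤ))
    have hθ : HasCompactSupport fun g : ↥(unitaryGroupOfForm (galAdicCompletionMap (L := L) (IsCMField.complexConj L) hw)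
        ((StdForm.antidiagonal 3).over (w.1.adicCompletion L))) => B u' (ρ g u) :=
      hsc.hasCompactSupport_sesqForm_apply_apply hZc hsm hBinv u u'
    -- Harish-Chandra's Lemma 14 at the model, `K = {m}`, `C = tsupport θ_M`
    have hA := UnitaryGroupOfForm.isCompact_image_mk_setOf_exists_conj_mem_of_charpoly_separable (m := 3) two_ne_zero hσc hσσ
      (K2E3SupercuspModelFrameAtPlace.over_three_hermitian (galAdicCompletionMap (L := L) (IsCMField.complexConj L) hw))
      K2E3SupercuspModelFrameAtPlace.isUnit_det_over_three m hreg isCompact_singleton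
      (Set.singleton_subset_iff.2 (Subgroup.mem_centralizer_singleton_iff.2 rfl)) (fun t' ht' => by rw [Set.mem_singleton_iff.1 ht']; exact hreg) hθ.isCompact
    have hset : {x : ↥(unitaryGroupOfForm (galAdicCompletionMap (L := L) (IsCMField.complexConj L) hw) ((StdForm.antidiagonal 3).over (w.1.adicCompletion L))) |
        ∃ t' ∈ ({m} : Set _), x * t' * x⁻¹ ∈ tsupport fun g : ↥(unitaryGroupOfForm (galAdicCompletionMap (L := L) (IsCMField.complexConj L) hw)
          ((StdForm.antidiagonal 3).over (w.1.adicCompletion L))) => B u' (ρ g u)} =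
        {x | x * m * x⁻¹ ∈ tsupport fun g : ↥(unitaryGroupOfForm (galAdicCompletionMap (L := L) (IsCMField.complexConj L) hw)
          ((StdForm.antidiagonal 3).over (w.1.adicCompletion L))) => B u' (ρ g u)} := by
      ext x; simp only [Set.mem_setOf_eq, Set.mem_singleton_iff, exists_eq_left]
    rw [hset] at hA
    obtain ⟨C, hC, hsub⟩ := K2E3UnipotentConjTwistBochner.exists_isCompact_subset_mul_of_isCompact_image_mk (Subgroup.centralizer {m}) hA
    -- the support set is closed, inside the compact `C · Z(m)`
    have hScl : IsClosed {x : ↥(unitaryGroupOfForm (galAdicCompletionMap (L := L) (IsCMField.complexConj L) hw) ((StdForm.antidiagonal 3).over (w.1.adicCompletion L))) |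
        x * m * x⁻¹ ∈ tsupport fun g : ↥(unitaryGroupOfForm (galAdicCompletionMap (L := L) (IsCMField.complexConj L) hw)
          ((StdForm.antidiagonal 3).over (w.1.adicCompletion L))) => B u' (ρ g u)} :=
      (isClosed_tsupport _).preimage ((continuous_id.mul continuous_const).mul continuous_inv)
    have hScpt := (hC.mul hZ).of_isClosed_subset hScl hsub
    refine exists_forall_setIntegral_sdiff_eq_zero_of_subset μ Ω _ hScpt fun x hx => ?_
    exact image_eq_zero_of_notMem_tsupport (f := fun g : ↥(unitaryGroupOfForm (galAdicCompletionMap (L := L) (IsCMField.complexConj L) hw)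
      ((StdForm.antidiagonal 3).over (w.1.adicCompletion L))) => B u' (ρ g u)) fun hx' => hx hx'
  · -- SPLIT type: `m = y t y⁻¹`, `t` regular diagonal (★ FILE B (d)) — Theorem 20 pays (★ [M4]), with the support datum ★ FILE B (f)
    obtain ⟨y, t, d, hd, htreg, rfl, -⟩ := K2E3SupercuspModelFrameAtPlaceCartan.exists_conj_torusU_of_not_isCompact_centralizer L w hw hJ hreg hZ
    exact K2E3SupercuspidalTruncatedCharThm20.setIntegral_sdiff_heightBall_coeff_conj_eq_zero (galAdicCompletionMap (L := L) (IsCMField.complexConj L) hw)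
      hσσ hσc hσv two_ne_zero hJ μ hϖ hϖ'0 hϖ'1 hσϖ' hZs hZc Ω hmem hinv hmul ρ hsm hsc B hBinv u u' t hd htreg
      (K2E3SupercuspModelFrameAtPlaceCartan.exists_isCompact_support_coeff_conj_subset_mul_torusU L w hw hJ ρ hsm hsc B hBinv t hd htreg u u') y

/-- **THE TWO CONSUMER SHAPES HOLD HAAR-ALMOST EVERYWHERE ON THE MODEL** `M = U(σ_w, Φ₃)(L_w)` (`μ` ANY Haar measure, `Ω` the height balls, `θ_M` a smooth supercuspidal
coefficient): for `μ`-a.e. `m` ONE radius `R` gives `∫_{Ω n} θ_M(x m x⁻¹) = ∫_{Ω n ∩ Ω R} θ_M(x m x⁻¹)` for all `n` AND `∫_{Ω n} → ∫_{Ω R}` — the previous theorem through ★ (f1) §4,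
regular elements being of full measure (★ [M2a] FILE A (e), Lemma 42). [cite: HarishChandra1970, Part VII §3 p. 71 eq. (1), p. 72; Part V Lemma 42] [cite: Rogawski1990, §12.5 p. 182] -/
theorem ae_exists_truncated_eq_inter_and_tendsto_model {J : Matrix (Fin 3) (Fin 3) (w.1.adicCompletion L)}
    (hJ : J = (StdForm.antidiagonal 3).over (w.1.adicCompletion L))
    [MeasurableSpace ↥(unitaryGroupOfForm (galAdicCompletionMap (L := L) (IsCMField.complexConj L) hw) J)]
    [BorelSpace ↥(unitaryGroupOfForm (galAdicCompletionMap (L := L) (IsCMField.complexConj L) hw) J)]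
    (μ : Measure ↥(unitaryGroupOfForm (galAdicCompletionMap (L := L) (IsCMField.complexConj L) hw) J)) [μ.IsHaarMeasure]
    (Ω : CompactExhaustion ↥(unitaryGroupOfForm (galAdicCompletionMap (L := L) (IsCMField.complexConj L) hw) J)) {ϖ : w.1.adicCompletion L}
    (hϖ : Valued.v ϖ = WithZero.exp (-1 : ℤ))
    (hmem : ∀ (m : ℕ) (g : ↥(unitaryGroupOfForm (galAdicCompletionMap (L := L) (IsCMField.complexConj L) hw) J)), g ∈ Ω m ↔
      (∀ i j, Valued.v (ϖ ^ m * ((g : GL (Fin 3) (w.1.adicCompletion L)) : Matrix (Fin 3) (Fin 3) (w.1.adicCompletion L)) i j) ≤ 1) ∧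
        ∀ i j, Valued.v (ϖ ^ m * (((g : GL (Fin 3) (w.1.adicCompletion L))⁻¹ : GL (Fin 3) (w.1.adicCompletion L)) :
          Matrix (Fin 3) (Fin 3) (w.1.adicCompletion L)) i j) ≤ 1)
    (hinv : ∀ (m : ℕ) (g : ↥(unitaryGroupOfForm (galAdicCompletionMap (L := L) (IsCMField.complexConj L) hw) J)), g ∈ Ω m → g⁻¹ ∈ Ω m)
    (hmul : ∀ (a b : ℕ) (g h : ↥(unitaryGroupOfForm (galAdicCompletionMap (L := L) (IsCMField.complexConj L) hw) J)), g ∈ Ω a → h ∈ Ω b → g * h ∈ Ω (a + b))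
    {V : Type*} [AddCommGroup V] [Module ℂ V]
    (ρ : Representation ℂ ↥(unitaryGroupOfForm (galAdicCompletionMap (L := L) (IsCMField.complexConj L) hw) J) V) (hsm : ρ.IsSmooth) (hsc : ρ.IsSupercuspidal)
    (B : V →ₗ⋆[ℂ] V →ₗ[ℂ] ℂ)
    (hBinv : ∀ (g : ↥(unitaryGroupOfForm (galAdicCompletionMap (L := L) (IsCMField.complexConj L) hw) J)) (x y : V), B (ρ g x) (ρ g y) = B x y) (u u' : V) :
    ∀ᵐ m ∂μ, ∃ R : ℕ,
      (∀ n : ℕ, ∫ x in Ω n, B u' (ρ (x * m * x⁻¹) u) ∂μ = ∫ x in Ω n ∩ Ω R, B u' (ρ (x * m * x⁻¹) u) ∂μ) ∧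
      Tendsto (fun n : ℕ => ∫ x in Ω n, B u' (ρ (x * m * x⁻¹) u) ∂μ) atTop (𝓝 (∫ x in Ω R, B u' (ρ (x * m * x⁻¹) u) ∂μ)) := by
  filter_upwards [K2E3SupercuspModelFrameAtPlace.ae_isRegularElt_of_eq_over L w hw hJ μ] with m hreg
  obtain ⟨R, hR⟩ := exists_forall_setIntegral_sdiff_coeff_conj_eq_zero_of_isRegularElt L w hw hJ μ Ω hϖ hmem hinv hmul ρ hsm hsc B hBinv u u' m hreg
  have hφ : Continuous fun x : ↥(unitaryGroupOfForm (galAdicCompletionMap (L := L) (IsCMField.complexConj L) hw) J) => B u' (ρ (x * m * x⁻¹) u) :=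
    K2E3SupercuspOrbitalSliceCuspidalModel.continuous_coeff_conj (galAdicCompletionMap (L := L) (IsCMField.complexConj L) hw) ρ hsm B m u u'
  have hmeas : ∀ n : ℕ, MeasurableSet (Ω n : Set ↥(unitaryGroupOfForm (galAdicCompletionMap (L := L) (IsCMField.complexConj L) hw) J)) :=
    fun n => (Ω.isCompact n).measurableSet
  have hint : ∀ n : ℕ, IntegrableOn (fun x : ↥(unitaryGroupOfForm (galAdicCompletionMap (L := L) (IsCMField.complexConj L) hw) J) => B u' (ρ (x * m * x⁻¹) u)) (Ω n) μ :=
    fun n => hφ.continuousOn.integrableOn_compact (Ω.isCompact n)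
  exact ⟨R, K2E3RightInvariantSetIntegralVanishing.setIntegral_eq_setIntegral_inter_of_sdiff_eq_zero μ Ω hmeas R _ hint hR,
    K2E3RightInvariantSetIntegralVanishing.tendsto_setIntegral_of_forall_sdiff_eq_zero μ Ω (fun _ _ h => Ω.subset h) hmeas R _ hint hR⟩

end Model

/-! ## §3 The carrier `G = (cmDatum L 3 H).Local v` = `U₃(H)(L⁺_v)`, `v` non-split: the guard-free a.e. statement and the consumers' binders -/

section Carrier

variable (L : Type) [Field L] [NumberField L] [IsCMField L] (H : Matrix (Fin 3) (Fin 3) L)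

/-- **THE ISOTROPIC BRANCH, ALONG A GIVEN FIELD MODEL `e : G ≃ₜ* M = U(σ_w, Φ₃)(L_w)`** (`G = (cmDatum L 3 H).Local v`; `e` ANY isomorphism of topological groups — ★ (f2)
supplies one when `H_w` is isotropic): with `Ω := e⁻¹(Ω_M)` (★ p856390, ★ [M5′] §1), for `μ`-a.e. `g` ONE radius `R` gives both shapes for `θ = B u′ (ρ(·) u)`.  Previous theorem
on `M` for `ρ_M = ρ ∘ e⁻¹` (★ [M5′] §3) and `e_* μ`, pulled back (Mathlib `ae_of_ae_map`) and transported (★ [M5′] §2); `ρ_M` is GENERALISED in the proof so that every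
unification is first order. [cite: HarishChandra1970, Part VII §3 p. 71 eq. (1), p. 72] [cite: PlatonovRapinchuk1994, §5.1] [cite: Folland1995, §2.4] -/
theorem exists_exhaustion_ae_truncated_eq_inter_and_tendsto_of_fieldModel
    {v : HeightOneSpectrum (𝓞 ↥(maximalRealSubfield L))} (w : PlacesOver L v) (hw : IsCMField.complexConj L • w.1 = w.1)
    [MeasurableSpace ((UnitaryGroup.cmDatum L 3 H).Local v)] [BorelSpace ((UnitaryGroup.cmDatum L 3 H).Local v)]
    (μ : Measure ((UnitaryGroup.cmDatum L 3 H).Local v)) [μ.IsHaarMeasure]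
    (e : (UnitaryGroup.cmDatum L 3 H).Local v ≃ₜ*
      ↥(unitaryGroupOfForm (galAdicCompletionMap (L := L) (IsCMField.complexConj L) hw) ((StdForm.antidiagonal 3).over (w.1.adicCompletion L))))
    {V : Type*} [AddCommGroup V] [Module ℂ V] (ρ : Representation ℂ ((UnitaryGroup.cmDatum L 3 H).Local v) V) (hsm : ρ.IsSmooth) (hsc : ρ.IsSupercuspidal)
    (B : V →ₗ⋆[ℂ] V →ₗ[ℂ] ℂ) (hBinv : ∀ (g : (UnitaryGroup.cmDatum L 3 H).Local v) (x y : V), B (ρ g x) (ρ g y) = B x y) (u u' : V) :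
    ∃ Ω : CompactExhaustion ((UnitaryGroup.cmDatum L 3 H).Local v), ∀ᵐ g ∂μ, ∃ R : ℕ,
      (∀ n : ℕ, ∫ x in Ω n, B u' (ρ (x * g * x⁻¹) u) ∂μ = ∫ x in Ω n ∩ Ω R, B u' (ρ (x * g * x⁻¹) u) ∂μ) ∧
      Tendsto (fun n : ℕ => ∫ x in Ω n, B u' (ρ (x * g * x⁻¹) u) ∂μ) atTop (𝓝 (∫ x in Ω R, B u' (ρ (x * g * x⁻¹) u) ∂μ)) := by
  letI iM : MeasurableSpace ↥(unitaryGroupOfForm (galAdicCompletionMap (L := L) (IsCMField.complexConj L) hw) ((StdForm.antidiagonal 3).over (w.1.adicCompletion L))) :=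
    borel _
  haveI : BorelSpace ↥(unitaryGroupOfForm (galAdicCompletionMap (L := L) (IsCMField.complexConj L) hw) ((StdForm.antidiagonal 3).over (w.1.adicCompletion L))) := ⟨rfl⟩
  haveI : (μ.map e).IsHaarMeasure := ContinuousMulEquiv.isHaarMeasure_map μ e
  -- the height balls of `M` (★ p856390) and their pull-back `Ω := e⁻¹ Ω_M` (★ [M5′] §1)
  haveI := compactSpace_integer_adicCompletion L w.1
  obtain ⟨ϖ, hϖ⟩ := exists_v_eq_exp_neg_one_adicCompletion (E := L) w.1
  obtain ⟨ΩM, hmem, -, hinv, hmul, -⟩ := K2E3HeightBallExhaustion.exists_heightBall_compactExhaustion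
    (galAdicCompletionMap (L := L) (IsCMField.complexConj L) hw) ((StdForm.antidiagonal 3).over (w.1.adicCompletion L))
    (continuous_galAdicCompletionMap L (IsCMField.complexConj L) hw) hϖ
  obtain ⟨Ω, hΩ⟩ := K2E3TruncatedCharTransport.exists_compactExhaustion_preimage e.toHomeomorph ΩM
  refine ⟨Ω, ?_⟩
  -- GENERALISATION over the transported datum `ρ_M` (instantiated below at `ρ ∘ e⁻¹`, ★ [M5′] §3)
  suffices key : ∀ ρM : Representation ℂ
      ↥(unitaryGroupOfForm (galAdicCompletionMap (L := L) (IsCMField.complexConj L) hw) ((StdForm.antidiagonal 3).over (w.1.adicCompletion L))) V,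
      ρM.IsSmooth → ρM.IsSupercuspidal → (∀ m (x y : V), B (ρM m x) (ρM m y) = B x y) → (∀ z : (UnitaryGroup.cmDatum L 3 H).Local v, ρM (e z) = ρ z) →
      ∀ᵐ g ∂μ, ∃ R : ℕ,
        (∀ n : ℕ, ∫ x in Ω n, B u' (ρ (x * g * x⁻¹) u) ∂μ = ∫ x in Ω n ∩ Ω R, B u' (ρ (x * g * x⁻¹) u) ∂μ) ∧
        Tendsto (fun n : ℕ => ∫ x in Ω n, B u' (ρ (x * g * x⁻¹) u) ∂μ) atTop (𝓝 (∫ x in Ω R, B u' (ρ (x * g * x⁻¹) u) ∂μ)) by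
    exact key _ (K2E3TruncatedCharTransport.isSmooth_comp_continuousMulEquiv_symm e ρ hsm)
      (K2E3TruncatedCharTransport.isSupercuspidal_comp_continuousMulEquiv_symm e ρ hsc) (fun m x y => hBinv _ x y)
      (fun z => by rw [MonoidHom.comp_apply, MonoidHom.coe_coe, ContinuousMulEquiv.symm_apply_apply])
  intro ρM hsmM hscM hBinvM hρM
  -- §2 on the model, a.e. for the Haar measure `e_* μ`, pulled back along `e` (Mathlib `ae_of_ae_map`)
  have hM := ae_exists_truncated_eq_inter_and_tendsto_model L w hw rfl (μ.map e) ΩM hϖ hmem hinv hmul ρM hsmM hscM B hBinvM u u'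
  filter_upwards [ae_of_ae_map e.continuous.measurable.aemeasurable hM] with g hg
  obtain ⟨R, hcanc, hlim⟩ := hg
  -- transport of the two shapes (★ [M5′] §2) and `ρ_M(e z) = ρ(z)`
  have hT := K2E3TruncatedCharTransport.truncated_eq_inter_and_tendsto_of_map e μ (fun m => B u' (ρM m u)) ΩM Ω hΩ g hcanc hlim
  simp only [hρM] at hT
  exact ⟨R, hT⟩

/-- **THE ANISOTROPIC BRANCH**: if `H_w` is anisotropic, `G = (cmDatum L 3 H).Local v` is COMPACT (★ `compactSpace_local_of_anisotropic`) and for ANY exhaustion, EVERY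
`g` and EVERY integrand ONE radius gives both shapes (§1). [cite: PlatonovRapinchuk1994, §3.1 Thm. 3.1] [cite: Rogawski1990, §14.2 p. 232] -/
theorem forall_exists_truncated_eq_inter_and_tendsto_of_anisotropic
    {v : HeightOneSpectrum (𝓞 ↥(maximalRealSubfield L))} (w : PlacesOver L v) (hw : IsCMField.complexConj L • w.1 = w.1)
    (hanis : ∀ x : Fin 3 → w.1.adicCompletion L,
      UnitaryGroup.hermForm (galAdicCompletionMap (L := L) (IsCMField.complexConj L) hw) (placeForm H w.1) x x = 0 → x = 0)
    [MeasurableSpace ((UnitaryGroup.cmDatum L 3 H).Local v)] (μ : Measure ((UnitaryGroup.cmDatum L 3 H).Local v))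
    (Ω : CompactExhaustion ((UnitaryGroup.cmDatum L 3 H).Local v))
    {E : Type*} [NormedAddCommGroup E] [NormedSpace ℝ E] (ψ : (UnitaryGroup.cmDatum L 3 H).Local v → (UnitaryGroup.cmDatum L 3 H).Local v → E) :
    ∀ g : (UnitaryGroup.cmDatum L 3 H).Local v, ∃ R : ℕ, (∀ n : ℕ, ∫ x in Ω n, ψ g x ∂μ = ∫ x in Ω n ∩ Ω R, ψ g x ∂μ) ∧
      Tendsto (fun n : ℕ => ∫ x in Ω n, ψ g x ∂μ) atTop (𝓝 (∫ x in Ω R, ψ g x ∂μ)) := by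
  haveI : CompactSpace ((UnitaryGroup.cmDatum L 3 H).Local v) :=
    compactSpace_local_of_anisotropic (IsCMField.complexConj L) H v w hw (IsCMField.complexConj_ne_one L) hanis
  exact forall_exists_truncated_eq_inter_and_tendsto_of_compactSpace μ Ω ψ

/-- **[M6] MAIN — LIMIT AND CANCELLATION OF THE TRUNCATED SUPERCUSPIDAL CHARACTER INTEGRALS, HAAR-A.E., GUARD-FREE.**  `H ∈ M₃(L)` hermitian, `det H ≠ 0`, `v`
NON-SPLIT, `μ` Haar on `G = (cmDatum L 3 H).Local v`, `ρ` smooth SUPERCUSPIDAL (no irreducibility) with invariant `B`, `θ = B u′ (ρ(·) u)`: there is a compact exhaustion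
`Ω` of `G` (depending on `(L, H, v)` only) such that for `μ`-a.e. `g` ONE radius `R` gives `∀ n, Θₙ(g) = ∫_{Ω n ∩ Ω R} θ(x g x⁻¹) dμ` AND `Θₙ(g) → Θ_R(g)`
(`Θₙ(g) = ∫_{Ω n} θ(x g x⁻¹) dμ`).  Dichotomy ★ (f2) `isotropic_or_anisotropic` on `H_w`: anisotropic ⇒ previous theorem with Mathlib `CompactExhaustion.choice`; isotropic ⇒
the field model of ★ (f2) and the theorem before.  REGULARITY ON `G` IS NEVER READ.
[cite: HarishChandra1970, Part VII §3 p. 71 eq. (1), p. 72; §2 Theorem 20 p. 70; Part I §3 Lemma 14 p. 9; Part V Lemma 42]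
[cite: Rogawski1990, §3.6 pp. 28–31, §12.2 p. 173, §12.5 p. 182, §14.2 p. 232] [cite: PlatonovRapinchuk1994, §3.1 Thm. 3.1, §5.1] -/
theorem exists_exhaustion_ae_truncated_eq_inter_and_tendsto (hH : (H.map (cmConjRingHom L))ᵀ = H) (hdet : H.det ≠ 0)
    (v : HeightOneSpectrum (𝓞 ↥(maximalRealSubfield L))) (hns : ∀ w : PlacesOver L v, IsCMField.complexConj L • w.1 = w.1)
    [MeasurableSpace ((UnitaryGroup.cmDatum L 3 H).Local v)] [BorelSpace ((UnitaryGroup.cmDatum L 3 H).Local v)]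
    (μ : Measure ((UnitaryGroup.cmDatum L 3 H).Local v)) [μ.IsHaarMeasure]
    {V : Type*} [AddCommGroup V] [Module ℂ V] (ρ : Representation ℂ ((UnitaryGroup.cmDatum L 3 H).Local v) V) (hsm : ρ.IsSmooth) (hsc : ρ.IsSupercuspidal)
    (B : V →ₗ⋆[ℂ] V →ₗ[ℂ] ℂ) (hBinv : ∀ (g : (UnitaryGroup.cmDatum L 3 H).Local v) (x y : V), B (ρ g x) (ρ g y) = B x y) (u u' : V) :
    ∃ Ω : CompactExhaustion ((UnitaryGroup.cmDatum L 3 H).Local v), ∀ᵐ g ∂μ, ∃ R : ℕ,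
      (∀ n : ℕ, ∫ x in Ω n, B u' (ρ (x * g * x⁻¹) u) ∂μ = ∫ x in Ω n ∩ Ω R, B u' (ρ (x * g * x⁻¹) u) ∂μ) ∧
      Tendsto (fun n : ℕ => ∫ x in Ω n, B u' (ρ (x * g * x⁻¹) u) ∂μ) atTop (𝓝 (∫ x in Ω R, B u' (ρ (x * g * x⁻¹) u) ∂μ)) := by
  obtain ⟨w⟩ := (inferInstance : Nonempty (PlacesOver L v))
  have hw : IsCMField.complexConj L • w.1 = w.1 := hns w
  rcases K2E3RankOneIsotropicPhi3Model.isotropic_or_anisotropic (σ := galAdicCompletionMap (L := L) (IsCMField.complexConj L) hw) (placeForm H w.1) with hiso | hanis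
  · -- ISOTROPIC `H_w`: the quasi-split field model (★ (f2))
    obtain ⟨e⟩ := K2E3RankOneIsotropicPhi3Model.nonempty_continuousMulEquiv_cmLocal_fieldModel_of_isotropic L H hH (isUnit_iff_ne_zero.2 hdet) w hw hiso
    exact exists_exhaustion_ae_truncated_eq_inter_and_tendsto_of_fieldModel L H w hw μ e ρ hsm hsc B hBinv u u'
  · -- ANISOTROPIC `H_w`: compact group, stationary exhaustion
    exact ⟨CompactExhaustion.choice _, Eventually.of_forall
      (forall_exists_truncated_eq_inter_and_tendsto_of_anisotropic L H w hw hanis μ _ fun g x => B u' (ρ (x * g * x⁻¹) u))⟩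

/-- **[M6] IN THE CONSUMERS' BINDERS — `Ω`, `F`, `Bset`, `hBsetc`, `hlim`, `hcanc`** — TOKEN FOR TOKEN the `hlim` of ★ `…OfTruncated.exists_locallyIntegrable_smoothTrace_eq_of_truncated`
and the `hcanc` (with `hBsetc`) of ★ `…DominationOfBricks.truncatedCharDominated_of_bricks` ∕ `sigSCan_datum_of_bricks` at `N = 3`, `ρ := r.ρ`, `u = u′ := v₁`, from the MAIN
theorem with `F g := Θ_{R(g)}(g)`, `Bset g := Ω (R g)` for its a.e.-defined radius (`Classical.epsilon`; the guard `¬ (IsRegularElt g ∧ IsCompact Z(g))` is idle).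
[cite: HarishChandra1970, Part VII §3 pp. 70–73] [cite: Rogawski1990, §12.2 p. 173, §12.5 p. 182] -/
theorem exists_exhaustion_limit_localisation (hH : (H.map (cmConjRingHom L))ᵀ = H) (hdet : H.det ≠ 0)
    (v : HeightOneSpectrum (𝓞 ↥(maximalRealSubfield L))) (hns : ∀ w : PlacesOver L v, IsCMField.complexConj L • w.1 = w.1)
    [MeasurableSpace ((UnitaryGroup.cmDatum L 3 H).Local v)] [BorelSpace ((UnitaryGroup.cmDatum L 3 H).Local v)]
    (μ : Measure ((UnitaryGroup.cmDatum L 3 H).Local v)) [μ.IsHaarMeasure]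
    {V : Type*} [AddCommGroup V] [Module ℂ V] (ρ : Representation ℂ ((UnitaryGroup.cmDatum L 3 H).Local v) V) (hsm : ρ.IsSmooth) (hsc : ρ.IsSupercuspidal)
    (B : V →ₗ⋆[ℂ] V →ₗ[ℂ] ℂ) (hBinv : ∀ (g : (UnitaryGroup.cmDatum L 3 H).Local v) (x y : V), B (ρ g x) (ρ g y) = B x y) (u u' : V) :
    ∃ (Ω : CompactExhaustion ((UnitaryGroup.cmDatum L 3 H).Local v)) (F : (UnitaryGroup.cmDatum L 3 H).Local v → ℂ)
      (Bset : (UnitaryGroup.cmDatum L 3 H).Local v → Set ((UnitaryGroup.cmDatum L 3 H).Local v)),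
      (∀ g, IsCompact (Bset g)) ∧
      (∀ᵐ g ∂μ, ¬ (IsRegularElt (g.val : GL (Fin 3) (UnitaryGroup.LocalRing L v)) ∧
          IsCompact ((Subgroup.centralizer ({g} : Set ((UnitaryGroup.cmDatum L 3 H).Local v))) : Set ((UnitaryGroup.cmDatum L 3 H).Local v))) →
        Tendsto (fun n => ∫ x in Ω n, B u' (ρ (x * g * x⁻¹) u) ∂μ) atTop (𝓝 (F g))) ∧
      (∀ n : ℕ, ∀ᵐ g ∂μ, ¬ (IsRegularElt (g.val : GL (Fin 3) (UnitaryGroup.LocalRing L v)) ∧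
          IsCompact ((Subgroup.centralizer ({g} : Set ((UnitaryGroup.cmDatum L 3 H).Local v))) : Set ((UnitaryGroup.cmDatum L 3 H).Local v))) →
        ∫ x in Ω n, B u' (ρ (x * g * x⁻¹) u) ∂μ = ∫ x in Ω n ∩ Bset g, B u' (ρ (x * g * x⁻¹) u) ∂μ) := by
  obtain ⟨Ω, hae⟩ := exists_exhaustion_ae_truncated_eq_inter_and_tendsto L H hH hdet v hns μ ρ hsm hsc B hBinv u u'
  -- the a.e.-defined radius `R g` (`Classical.epsilon`), the limit `F g := Θ_{R g}(g)` and the ball `Bset g := Ω (R g)`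
  let P : (UnitaryGroup.cmDatum L 3 H).Local v → ℕ → Prop := fun g R =>
    (∀ n : ℕ, ∫ x in Ω n, B u' (ρ (x * g * x⁻¹) u) ∂μ = ∫ x in Ω n ∩ Ω R, B u' (ρ (x * g * x⁻¹) u) ∂μ) ∧
      Tendsto (fun n : ℕ => ∫ x in Ω n, B u' (ρ (x * g * x⁻¹) u) ∂μ) atTop (𝓝 (∫ x in Ω R, B u' (ρ (x * g * x⁻¹) u) ∂μ))
  let R : (UnitaryGroup.cmDatum L 3 H).Local v → ℕ := fun g => Classical.epsilon (P g)
  have hR : ∀ g, (∃ R₀ : ℕ, P g R₀) → P g (R g) := fun g hg => Classical.epsilon_spec hg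
  refine ⟨Ω, fun g => ∫ x in Ω (R g), B u' (ρ (x * g * x⁻¹) u) ∂μ, fun g => Ω (R g), fun g => Ω.isCompact (R g), ?_, fun n => ?_⟩
  · filter_upwards [hae] with g hg _
    exact (hR g hg).2
  · filter_upwards [hae] with g hg _
    exact (hR g hg).1 n

/-! ## §4 Docking: the (SC-an) datum statement MODULO the domination bricks `hballE`, `hball`, `hW` ([M5]) — kernel-checked by name -/

/-- **DOCKING — (SC-an) FOR A SUPERCUSPIDAL DATUM ⟸ [M6] ⊕ [M5]**: for `r` a supercuspidal `SmoothIrrep` of `G = (cmDatum L 3 H).Local v` (`v` non-split), invariant `B`, `v₁`: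
there are compact balls `Bset g` (`= Ω (R g)` of §3) such that the ONLY remaining inputs of the (SC-an) ∃-statement `∃ Ω F M, (SC-lim∖ell) ∧ (SC-dom) ∧ M ∈ L¹_loc` (consumed by
★ p856184 `charLocIntNearSemisimple_supercuspidal_of_exists_truncated`) are the DOMINATION BRICKS of ★ p856355 for a weight `W` — `hballE`, `hball` (over `Bset g`), `hW` —
Harish-Chandra's Theorems 14, 15, 18, 19 ([M5], NOT proved here).  One line over ★ `sigSCan_datum_of_bricks`. [cite: HarishChandra1970, Part VII §3 pp. 70–73; Thms 14, 15, 18–20]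
[cite: Rogawski1990, §12.2 p. 173] -/
theorem sigSCan_datum_of_domination_bricks (hH : (H.map (cmConjRingHom L))ᵀ = H) (hdet : H.det ≠ 0)
    (v : HeightOneSpectrum (𝓞 ↥(maximalRealSubfield L))) (hns : ∀ w : PlacesOver L v, IsCMField.complexConj L • w.1 = w.1)
    [MeasurableSpace ((UnitaryGroup.cmDatum L 3 H).Local v)] [BorelSpace ((UnitaryGroup.cmDatum L 3 H).Local v)]
    (μ : Measure ((UnitaryGroup.cmDatum L 3 H).Local v)) [μ.IsHaarMeasure]
    (r : SmoothIrrep ((UnitaryGroup.cmDatum L 3 H).Local v)) (hsc : r.ρ.IsSupercuspidal)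
    (B : r.V →ₗ⋆[ℂ] r.V →ₗ[ℂ] ℂ) (hBinv : ∀ (g : (UnitaryGroup.cmDatum L 3 H).Local v) (x y : r.V), B (r.ρ g x) (r.ρ g y) = B x y) (v₁ : r.V) :
    ∃ Bset : (UnitaryGroup.cmDatum L 3 H).Local v → Set ((UnitaryGroup.cmDatum L 3 H).Local v),
      (∀ g, IsCompact (Bset g)) ∧
      ∀ W : (UnitaryGroup.cmDatum L 3 H).Local v → ℝ,
        (∀ᵐ g ∂μ, (IsRegularElt (g.val : GL (Fin 3) (UnitaryGroup.LocalRing L v)) ∧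
            IsCompact ((Subgroup.centralizer ({g} : Set ((UnitaryGroup.cmDatum L 3 H).Local v))) : Set ((UnitaryGroup.cmDatum L 3 H).Local v))) →
          ∫ x, ‖B v₁ (r.ρ (x * g * x⁻¹) v₁)‖ ∂μ ≤ W g) →
        (∀ᵐ g ∂μ, ¬ (IsRegularElt (g.val : GL (Fin 3) (UnitaryGroup.LocalRing L v)) ∧
            IsCompact ((Subgroup.centralizer ({g} : Set ((UnitaryGroup.cmDatum L 3 H).Local v))) : Set ((UnitaryGroup.cmDatum L 3 H).Local v))) →
          ∫ x in Bset g, ‖B v₁ (r.ρ (x * g * x⁻¹) v₁)‖ ∂μ ≤ W g) →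
        LocallyIntegrable W μ →
        ∃ (Ω' : CompactExhaustion ((UnitaryGroup.cmDatum L 3 H).Local v))
          (F' : (UnitaryGroup.cmDatum L 3 H).Local v → ℂ) (M : (UnitaryGroup.cmDatum L 3 H).Local v → ℝ),
          (∀ᵐ g ∂μ, ¬ (IsRegularElt (g.val : GL (Fin 3) (UnitaryGroup.LocalRing L v)) ∧
              IsCompact ((Subgroup.centralizer ({g} : Set ((UnitaryGroup.cmDatum L 3 H).Local v))) : Set ((UnitaryGroup.cmDatum L 3 H).Local v))) →
            Tendsto (fun n => ∫ x in Ω' n, B v₁ (r.ρ (x * g * x⁻¹) v₁) ∂μ) atTop (𝓝 (F' g))) ∧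
          (∀ n : ℕ, ∀ᵐ g ∂μ, ‖∫ x in Ω' n, B v₁ (r.ρ (x * g * x⁻¹) v₁) ∂μ‖ ≤ M g) ∧
          LocallyIntegrable M μ := by
  obtain ⟨Ω, F, Bset, hBsetc, hlim, hcanc⟩ :=
    exists_exhaustion_limit_localisation L H hH hdet v hns μ r.ρ r.isSmooth hsc B hBinv v₁ v₁
  exact ⟨Bset, hBsetc, fun W hballE hball hW =>
    K2E3SupercuspidalTruncatedCharDominationOfBricks.sigSCan_datum_of_bricks L 3 H hH hdet v hns μ r hsc B hBinv v₁ Ω F hlim Bset hBsetc hcanc W hballE hball hW⟩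

end Carrier

end Summit.HodgeConjecture.HodgeConjecture.Cruxes.H413.K2E3SupercuspidalTruncatedCharLimCanc

end
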